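import Literature.MeasureTheory.Group.InvariantQuotientExistence
import HarnessLib

/-!
# Invariant measures on `G ⧸ M` for a closed abelian subgroup `M` of a unimodular group
(Deitmar–Echterhoff, *Principles of Harmonic Analysis* (2014), Thm. 1.5.3 with Folland (1995),
§2.4: abelian groups are unimodular)

Topic `MeasureTheory/Group`; a corollary of `InvariantQuotientExistence` (existence of the
invariant Radon measure on `G ⧸ H` when a Haar measure of `G` is also right invariant and a Haar
measure of `H` is inversion invariant). For a **closed abelian** subgroup `M` the second condition
is automatic: a Haar measure of the locally compact abelian group `M` is inversion invariant
(Mathlib `IsHaarMeasure.isInvInvariant_of_regular`). Hence: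

* `isInvInvariant_of_comm` — a regular Haar measure on a closed abelian subgroup is inversion
  invariant;
* `exists_smulInvariantMeasure_quotient_of_comm` — for `G` locally compact second countable
  Hausdorff with a Haar measure that is also right invariant (unimodular `G`) and `M ≤ G` closed
  abelian, there is a non-zero `G`-invariant regular Borel measure on `G ⧸ M` (in particular
  finite on compact sets).

This supplies the invariant measures on `G(𝔸) ⧸ G_γ` and `G(𝔸) ⧸ (A_G · G(K)_γ)` for the regular
(non-central) classes in the trace formula of the multiplicative group of a division quaternion
algebra, whose centralisers `G_γ = K(γ)_𝔸^×` are abelian (Gelbart (1975), Remark 9.23); part of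
the inline (D-0026) decomposition of
`Literature.NumberTheory.Automorphic.strong_multiplicity_one_quaternionUnits`.

## References

* A. Deitmar, S. Echterhoff, *Principles of Harmonic Analysis*, 2nd ed. (2014), Thm. 1.5.3
  [DeitmarEchterhoff2014].
* G. B. Folland, *A Course in Abstract Harmonic Analysis* (1995), §2.4, Thm. 2.49 [Folland1995].
* S. Gelbart, *Automorphic forms on adele groups* (1975), Remark 9.23 [Gelbart1975].
-/

noncomputable section

open _root_.MeasureTheory _root_.MeasureTheory.Measure _root_.Topology Set Filter
open scoped ENNReal NNReal Pointwise

/- Work with Borel structures on the coset spaces, as in `InvariantQuotientExistence`. -/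
attribute [-instance] Quotient.instMeasurableSpace QuotientGroup.measurableSpace

namespace Literature.MeasureTheory.Group

section Abelian

variable {G : Type*} [Group G] [TopologicalSpace G] [IsTopologicalGroup G] [LocallyCompactSpace G]
  (M : Subgroup G)

/-- **A regular Haar measure on a closed abelian subgroup is inversion invariant** (abelian
locally compact groups are unimodular, Folland (1995), §2.4; Mathlib
`IsHaarMeasure.isInvInvariant_of_regular` for the abelian group `M`). [cite: Folland1995, §2.4] -/
theorem isInvInvariant_of_comm (hM : IsClosed (M : Set G))
    (hcomm : ∀ x ∈ M, ∀ y ∈ M, x * y = y * x) [MeasurableSpace M] [BorelSpace M]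
    (ρ : Measure M) [IsHaarMeasure ρ] [ρ.Regular] : ρ.IsInvInvariant := by
  letI : CommGroup M :=
    { (inferInstance : Group M) with mul_comm := fun x y => Subtype.ext (hcomm x x.2 y y.2) }
  haveI : LocallyCompactSpace M := hM.isClosedEmbedding_subtypeVal.locallyCompactSpace
  exact IsHaarMeasure.isInvInvariant_of_regular ρ

variable [SecondCountableTopology G] [T2Space G] [MeasurableSpace G] [BorelSpace G]
  [MeasurableSpace (G ⧸ M)] [BorelSpace (G ⧸ M)]

/-- **Existence of an invariant measure on `G ⧸ M` for `M` closed abelian and `G` unimodular**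
(Deitmar–Echterhoff (2014), Thm. 1.5.3: an invariant Radon measure on `G ⧸ H` exists iff
`Δ_G|_H = Δ_H`; here both sides are `1`). For `G` locally compact second countable Hausdorff with
a Haar measure `ν` that is also right invariant, and `M ≤ G` closed with `x y = y x` on `M`, there
is a non-zero `G`-invariant regular Borel measure on `G ⧸ M` (`quotientMeasure` for the Haar
measure of `M`, inversion invariant by `isInvInvariant_of_comm`). [cite: DeitmarEchterhoff2014, Thm. 1.5.3] -/
theorem exists_smulInvariantMeasure_quotient_of_comm (hM : IsClosed (M : Set G))
    (hcomm : ∀ x ∈ M, ∀ y ∈ M, x * y = y * x) (ν : Measure G) [IsHaarMeasure ν]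
    [ν.IsMulRightInvariant] :
    ∃ μ : Measure (G ⧸ M), SMulInvariantMeasure G (G ⧸ M) μ ∧ μ.Regular ∧ μ ≠ 0 := by
  letI : MeasurableSpace M := borel M
  haveI : BorelSpace M := ⟨rfl⟩
  haveI : LocallyCompactSpace M := hM.isClosedEmbedding_subtypeVal.locallyCompactSpace
  haveI : SecondCountableTopology M := TopologicalSpace.Subtype.secondCountableTopology _
  haveI : (Measure.haar : Measure M).IsInvInvariant :=
    isInvInvariant_of_comm M hM hcomm Measure.haar
  exact ⟨quotientMeasure M Measure.haar hM ν, smulInvariantMeasure_quotientMeasure M _ hM ν,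
    regular_quotientMeasure M _ hM ν, quotientMeasure_ne_zero M _ hM ν⟩

/-- The same, packaged with finiteness on compact sets (a regular measure is finite on compact
sets) — the form consumed by the chain-rule and conjugacy-sum files. [cite: DeitmarEchterhoff2014, Thm. 1.5.3] -/
theorem exists_smulInvariantMeasure_isFiniteMeasureOnCompacts_quotient_of_comm
    (hM : IsClosed (M : Set G)) (hcomm : ∀ x ∈ M, ∀ y ∈ M, x * y = y * x) (ν : Measure G)
    [IsHaarMeasure ν] [ν.IsMulRightInvariant] :
    ∃ μ : Measure (G ⧸ M), SMulInvariantMeasure G (G ⧸ M) μ ∧ IsFiniteMeasureOnCompacts μ ∧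
      μ ≠ 0 := by
  obtain ⟨μ, h1, h2, h3⟩ := exists_smulInvariantMeasure_quotient_of_comm M hM hcomm ν
  exact ⟨μ, h1, inferInstance, h3⟩

end Abelian

end Literature.MeasureTheory.Group
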